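import Summits.RiemannHypothesis.RiemannHypothesis.Theorems.SpectralTraceHeckeSurrogateDefs
import Summits.RiemannHypothesis.RiemannHypothesis.Theorems.SpectralTraceWindowTracePrime2StubXi2Surrogate
import Summits.RiemannHypothesis.RiemannHypothesis.Theorems.SpectralTraceWindowTracePrime2StubLogDerivDiff
import Summits.RiemannHypothesis.RiemannHypothesis.Theorems.SpectralTraceWindowTracePrime2StubContourIdentity
import Summits.RiemannHypothesis.RiemannHypothesis.Theorems.SpectralTraceWindowTracePrime2StubGoodHeights
import Literature.Uncategorized.GammaLowerBound
import Literature.NumberTheory.LFunctions.WeilExplicitFormulaProofs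
import Literature.NumberTheory.LFunctions.WeilExplicitRightEdge
import Literature.NumberTheory.LFunctions.WeilMellinInversion
import Literature.NumberTheory.LFunctions.RelativeExplicitFormulaPieces
import Mathlib.MeasureTheory.Integral.IntegralEqImproper
import HarnessLib

/-!
# The relative explicit formula for a surrogate — stub `stub_windowAssembly`

Route `RiemannHypothesis/SpectralTrace`, crux `WindowTracePrime2` (stmt-RiemannHypothesis-11196),
line `hecke-cusp-perturbation-surrogate`, registered stub **F** `stub_windowAssembly`
(skeleton `Cruxes/WindowTracePrime2/Lines/hecke_cusp_perturbation_surrogate.lean`; vocabulary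
`Theorems/SpectralTraceHeckeSurrogateDefs.lean`: `xi2`, `IsSurrogate`, `RightHalfPlaneControl`,
`ZeroCountBound`, `ZIdx`, `zval`).

Given the statements of the sibling stubs C (contour identity), D (good heights for a pair) and
E (zero-sum limit) as hypotheses, together with the interfaces `GammaLowerBound`,
`HorizontalLogDerivBound`, `IsSurrogate xi2`, `RightHalfPlaneControl`, `ZeroCountBound`: for every
surrogate `E` and every Weil test `g` supported in the window `[-log 3, log 3]`, the zeros of `E` counted
with multiplicity give `HasSum (i ↦ ĝ(ρ_i)) (W g)`.

Proof (Bombieri 2000, §2, run for `E` and for `ξ₂ = 2ξ` and subtracted). Fix `σ ≥ σ₁(E)` (the abscissa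
of `RightHalfPlaneControl E`; `σ₁ ≥ 2`). Stub D supplies heights `T_n ∈ [n+1, n+2]` good for both `E` and
`ξ₂` with `‖E'/E‖, ‖ξ₂'/ξ₂‖ ≤ C(2+n)^k` on the horizontal sides; stub C gives the two contour identities
on `[1-σ, σ] × [-T_n, T_n]`. In the difference: the `ξ₂` zero sum IS `weilZeroSidePartial g T_n → W(g)`
(`explicit_formula_holds`, `finsum_box_eq_weilZeroSidePartial`); the four horizontal sides tend to `0`
(`tendsto_horizontal_mul_weilMellin`); the vertical pieces combine into
`∫_{-T_n}^{T_n} (E'/E - ξ₂'/ξ₂)(σ+iy) k̂(σ+iy) dy → J(σ)`; stub E identifies the `E` zero sum limit with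
`S = ∑' ĝ(zval i)`. Hence `2π(S - W g) = J(σ)` for every `σ ≥ σ₁`, and
`‖J(σ)‖ ≤ K C_V/(σ-1/2)²` (`RightHalfPlaneControl` (ii): `‖E'/E - ξ₂'/ξ₂‖ ≤ C_V 3^{-σ}`, against
`|ĝ(σ+iy)| ≤ 3^{σ-1/2}‖g⁗‖₁/|s-1/2|⁴` for window-supported `g`: `norm_vertical_integral_window_le`), so
`S = W g`; absolute summability (stub E) turns `∑'` into `HasSum`.

References: E. Bombieri, *Remarks on Weil's quadratic functional in the theory of prime numbers I*,
Rend. Mat. Acc. Lincei (9) 11 (2000), §2 Thm 2 [Bombieri2000Weil]; E. Hecke, *Über die Bestimmung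
Dirichletscher Reihen durch ihre Funktionalgleichung*, Math. Ann. 112 (1936), §2 [Hecke1936].
-/

noncomputable section

set_option linter.dupNamespace false

namespace Summit.RiemannHypothesis.RiemannHypothesis.Theorems.HeckeSurrogate

open Complex Filter Set MeasureTheory
open scoped Real Topology Interval
open Literature.NumberTheory.LFunctions
open Literature.Uncategorized

/-! ## Zero-free regions of a controlled surrogate and of `ξ₂` -/

/-- With the symmetry `E(1-s) = E(s)` and the leading-term domination on `Re s ≥ σ₁ ≥ 2`
(`gh_ne_zero_of_control`: `E ≠ 0` there), all zeros of a controlled surrogate lie in the open strip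
`1 - σ < Re s < σ` for every `σ ≥ σ₁`. [folklore] -/
theorem wa_zero_strip {E : ℂ → ℂ} (hsymm : ∀ s : ℂ, E (1 - s) = E s) {σ₁ : ℝ} (hσ₁ : 2 ≤ σ₁)
    (hdom : ∀ s : ℂ, σ₁ ≤ s.re → ‖s * (s - 1) * s.Gammaℝ‖ ≤ 2 * ‖E s‖) {σ : ℝ} (hσ : σ₁ ≤ σ)
    {s : ℂ} (h0 : E s = 0) : 1 - σ < s.re ∧ s.re < σ := by
  by_contra h
  rw [not_and_or, not_lt, not_lt] at h
  rcases h with h | h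
  · have hne := gh_ne_zero_of_control hσ₁ hdom (s := 1 - s) (by simp; linarith)
    rw [hsymm] at hne
    exact hne h0
  · exact gh_ne_zero_of_control hσ₁ hdom (by linarith) h0

/-- `ξ₂ = 2ξ ≠ 0` on `Re s ≥ 1`. [folklore] -/
theorem wa_xi2_ne_zero {s : ℂ} (hs : 1 ≤ s.re) : xi2 s ≠ 0 :=
  mul_ne_zero two_ne_zero (riemannXi_ne_zero_of_one_le_re hs)

/-! ## The registered stub -/

/-- **STUB F · `stub_windowAssembly`** — the RELATIVE EXPLICIT FORMULA assembled from STUBS C, D, E and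
the interfaces: for a surrogate `E`, the zeros with multiplicity give `HasSum ĝ(ρ) = W(g)` for every Weil
test supported in the window `[-log 3, log 3]` (contour identities for `E` and `ξ₂` at common good heights,
subtracted; horizontal sides `→ 0`; the `ξ₂` zero sum is `weilZeroSidePartial g T → W g`
(`explicit_formula_holds`); the vertical difference tends to `J(σ) = ∫ (E'/E - ξ₂'/ξ₂)(σ+iy) k̂(σ+iy) dy`
with `‖J(σ)‖ ≤ K C 3^{-σ}3^{σ-1/2}/(σ-1/2)²`-type bound uniformly in `σ`; STUB E identifies the limit with
`∑' ĝ(zval i)` for every `σ`, so it is `W(g)`). [cite: Bombieri2000Weil, §2 Thm 2] -/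
theorem stub_windowAssembly :
    (∀ F : ℂ → ℂ, Differentiable ℂ F → (∀ s : ℂ, F (1 - s) = F s) →
      ∀ (σ T : ℝ), 1 / 2 < σ → 0 < T →
        (∀ s : ℂ, σ ≤ s.re → F s ≠ 0) →
        (∀ s : ℂ, F s = 0 → s.im ≠ T ∧ s.im ≠ -T) →
        ∀ g : ℝ → ℂ, IsWeilTest g →
          2 * π * I * ∑ᶠ ρ ∈ {ρ : ℂ | F ρ = 0 ∧ ρ ∈ Set.Ioo (1 - σ) σ ×ℂ Set.Ioo (-T) T},
              ((meromorphicOrderAt F ρ).untop₀ : ℂ) * weilMellin g ρ =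
            (∫ x : ℝ in (1 - σ)..σ, logDeriv F (x + (-T : ℝ) * I) * weilMellin g (x + (-T : ℝ) * I)) -
            (∫ x : ℝ in (1 - σ)..σ, logDeriv F (x + T * I) * weilMellin g (x + T * I)) +
            I * ∫ y : ℝ in (-T)..T, logDeriv F (σ + y * I) * weilMellin (weilSymm g) (σ + y * I)) →
    (GammaLowerBound → HorizontalLogDerivBound →
      ∀ F G : ℂ → ℂ, IsSurrogate F → IsSurrogate G →
        RightHalfPlaneControl F → RightHalfPlaneControl G → ZeroCountBound F → ZeroCountBound G →
        ∀ σ : ℝ, 1 / 2 < σ →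
          ∃ (C : ℝ) (k : ℕ), ∀ t : ℝ, 0 ≤ t → ∃ T ∈ Set.Icc t (t + 1),
            (∀ s : ℂ, F s = 0 → s.im ≠ T ∧ s.im ≠ -T) ∧ (∀ s : ℂ, G s = 0 → s.im ≠ T ∧ s.im ≠ -T) ∧
            ∀ x : ℝ, x ∈ Set.Icc (1 - σ) σ →
              ‖logDeriv F (x + T * I)‖ ≤ C * (1 + t) ^ k ∧
              ‖logDeriv F (x + (-T : ℝ) * I)‖ ≤ C * (1 + t) ^ k ∧
              ‖logDeriv G (x + T * I)‖ ≤ C * (1 + t) ^ k ∧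
              ‖logDeriv G (x + (-T : ℝ) * I)‖ ≤ C * (1 + t) ^ k) →
    (∀ E : ℂ → ℂ, Differentiable ℂ E → (∃ s : ℂ, E s ≠ 0) → ZeroCountBound E →
      ∀ σ : ℝ, (∀ s : ℂ, E s = 0 → 1 - σ < s.re ∧ s.re < σ) →
        ∀ g : ℝ → ℂ, IsWeilTest g →
          Summable (fun i : ZIdx E => ‖weilMellin g (zval i)‖) ∧
          ∀ T : ℕ → ℝ, Tendsto T atTop atTop →
            Tendsto (fun n : ℕ => ∑ᶠ ρ ∈ {ρ : ℂ | E ρ = 0 ∧ ρ ∈ Set.Ioo (1 - σ) σ ×ℂ Set.Ioo (-(T n)) (T n)},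
                ((meromorphicOrderAt E ρ).untop₀ : ℂ) * weilMellin g ρ) atTop
              (𝓝 (∑' i : ZIdx E, weilMellin g (zval i)))) →
    GammaLowerBound → HorizontalLogDerivBound → IsSurrogate xi2 →
      (∀ E : ℂ → ℂ, IsSurrogate E → RightHalfPlaneControl E) →
      (∀ E : ℂ → ℂ, IsSurrogate E → ZeroCountBound E) →
      ∀ E : ℂ → ℂ, IsSurrogate E →
        ∀ g : ℝ → ℂ, IsWeilTest g → tsupport g ⊆ Set.Icc (-Real.log 3) (Real.log 3) →
          HasSum (fun i : ZIdx E => weilMellin g (zval i)) (weilFunctional g) := by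
  intro hC hD hE h₁ h₂ h₅ hRHP hZCB E hS g hg hsupp
  obtain ⟨σ₁, Cv, hσ₁, hCv, hdom, hV⟩ := hRHP E hS
  have hEd : Differentiable ℂ E := hS.1
  have hsymm : ∀ s : ℂ, E (1 - s) = E s := hS.2.2.1
  have hEex : ∃ s : ℂ, E s ≠ 0 := ⟨σ₁, gh_ne_zero_of_control hσ₁ hdom (by simp)⟩
  have hk : IsWeilTest (weilSymm g) := hg.weilSymm
  -- the vertical bound on a line `Re s = σ ≥ σ₁`
  have hVline : ∀ σ : ℝ, σ₁ ≤ σ → ∀ y : ℝ,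
      ‖logDeriv E (σ + y * I) - logDeriv xi2 (σ + y * I)‖ ≤ Cv * (3 : ℝ) ^ (-σ) := by
    intro σ hσ y
    have h := hV (σ + y * I) (by simpa using hσ)
    simpa using h
  -- Step A: for every `σ ≥ σ₁`, `2π (S - W g) = J(σ)`
  have key : ∀ σ : ℝ, σ₁ ≤ σ → 2 * π * ((∑' i : ZIdx E, weilMellin g (zval i)) - weilFunctional g) =
      ∫ y : ℝ, (logDeriv E (σ + y * I) - logDeriv xi2 (σ + y * I)) *
        weilMellin (weilSymm g) (σ + y * I) := by
    intro σ hσ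
    have hσhalf : 1 / 2 < σ := by linarith
    have hσ1 : (1 : ℝ) ≤ σ := by linarith
    have hER : ∀ s : ℂ, σ ≤ s.re → E s ≠ 0 := fun s hs ↦ gh_ne_zero_of_control hσ₁ hdom (by linarith)
    have hXR : ∀ s : ℂ, σ ≤ s.re → xi2 s ≠ 0 := fun s hs ↦ wa_xi2_ne_zero (by linarith)
    -- good heights for the pair `(E, ξ₂)`
    obtain ⟨C, k, hCk⟩ := hD h₁ h₂ E xi2 hS h₅ (hRHP E hS) (hRHP xi2 h₅) (hZCB E hS) (hZCB xi2 h₅)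
      σ hσhalf
    choose T hTmem hgoodE hgoodX hbd using fun n : ℕ ↦ hCk ((n : ℝ) + 1) (by positivity)
    have hTge : ∀ n : ℕ, (n : ℝ) + 1 ≤ T n := fun n ↦ (hTmem n).1
    have hTpos : ∀ n : ℕ, 0 < T n := fun n ↦ by
      linarith [hTge n, (n.cast_nonneg : (0 : ℝ) ≤ n)]
    have hTtop : Tendsto T atTop atTop :=
      tendsto_atTop_mono hTge (tendsto_atTop_add_const_right atTop 1 tendsto_natCast_atTop_atTop)
    have habsT : ∀ n : ℕ, (n : ℝ) + 1 ≤ |T n| := fun n ↦ (hTge n).trans (le_abs_self _)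
    have habsT' : ∀ n : ℕ, (n : ℝ) + 1 ≤ |(-T n)| := fun n ↦ by rw [abs_neg]; exact habsT n
    -- the two contour identities (STUB C)
    have idE := fun n : ℕ ↦ hC E hEd hsymm σ (T n) hσhalf (hTpos n) hER (hgoodE n) g hg
    have idX := fun n : ℕ ↦
      hC xi2 differentiable_xi2 xi2_one_sub σ (T n) hσhalf (hTpos n) hXR (hgoodX n) g hg
    -- the zero sums (STUB E for `E`; the explicit formula for `ξ₂`)
    have hSE := (hE E hEd hEex (hZCB E hS) σ (fun s h0 ↦ wa_zero_strip hsymm hσ₁ hdom hσ h0)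
      g hg).2 T hTtop
    have hSX : Tendsto (fun n : ℕ ↦
        ∑ᶠ ρ ∈ {ρ : ℂ | xi2 ρ = 0 ∧ ρ ∈ Set.Ioo (1 - σ) σ ×ℂ Set.Ioo (-(T n)) (T n)},
          ((meromorphicOrderAt xi2 ρ).untop₀ : ℂ) * weilMellin g ρ) atTop (𝓝 (weilFunctional g)) := by
      have h : HasWeilZeroSide g (weilFunctional g) := explicit_formula_holds hg
      refine (h.comp hTtop).congr fun n ↦ ?_
      exact (finsum_box_eq_weilZeroSidePartial (F := xi2) two_ne_zero (fun s ↦ rfl) g hσ1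
        (hgoodX n)).symm
    -- the four horizontal sides tend to `0`
    have hIcc : ∀ x : ℝ, x ∈ Ι (1 - σ) σ → x ∈ Set.Icc (1 - σ) σ := fun x hx ↦ by
      rw [Set.uIoc_of_le (by linarith)] at hx
      exact ⟨hx.1.le, hx.2⟩
    have hbE : Tendsto (fun n : ℕ ↦ ∫ x : ℝ in (1 - σ)..σ,
        logDeriv E (x + (-T n : ℝ) * I) * weilMellin g (x + (-T n : ℝ) * I)) atTop (𝓝 0) :=
      tendsto_horizontal_mul_weilMellin hg (1 - σ) σ (fun n ↦ -T n) habsT'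
        (fun n x ↦ logDeriv E (x + (-T n : ℝ) * I)) C k (fun n x hx ↦ (hbd n x (hIcc x hx)).2.1)
    have htE : Tendsto (fun n : ℕ ↦ ∫ x : ℝ in (1 - σ)..σ,
        logDeriv E (x + T n * I) * weilMellin g (x + T n * I)) atTop (𝓝 0) :=
      tendsto_horizontal_mul_weilMellin hg (1 - σ) σ T habsT
        (fun n x ↦ logDeriv E (x + T n * I)) C k (fun n x hx ↦ (hbd n x (hIcc x hx)).1)
    have hbX : Tendsto (fun n : ℕ ↦ ∫ x : ℝ in (1 - σ)..σ,
        logDeriv xi2 (x + (-T n : ℝ) * I) * weilMellin g (x + (-T n : ℝ) * I)) atTop (𝓝 0) :=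
      tendsto_horizontal_mul_weilMellin hg (1 - σ) σ (fun n ↦ -T n) habsT'
        (fun n x ↦ logDeriv xi2 (x + (-T n : ℝ) * I)) C k (fun n x hx ↦ (hbd n x (hIcc x hx)).2.2.2)
    have htX : Tendsto (fun n : ℕ ↦ ∫ x : ℝ in (1 - σ)..σ,
        logDeriv xi2 (x + T n * I) * weilMellin g (x + T n * I)) atTop (𝓝 0) :=
      tendsto_horizontal_mul_weilMellin hg (1 - σ) σ T habsT
        (fun n x ↦ logDeriv xi2 (x + T n * I)) C k (fun n x hx ↦ (hbd n x (hIcc x hx)).2.2.1)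
    -- the vertical pieces: `∫_{-T_n}^{T_n} (E'/E - ξ₂'/ξ₂) k̂ → J(σ)`
    have hcE : Continuous fun y : ℝ ↦ logDeriv E (σ + y * I) :=
      ci_continuous_logDeriv_vertical hEd fun y ↦ hER _ (by simp)
    have hcX : Continuous fun y : ℝ ↦ logDeriv xi2 (σ + y * I) :=
      ci_continuous_logDeriv_vertical differentiable_xi2 fun y ↦ hXR _ (by simp)
    have hck : Continuous fun y : ℝ ↦ weilMellin (weilSymm g) (σ + y * I) :=
      continuous_weilMellin_vertical hk.1.continuous hk.2 σ
    have hint : Integrable fun y : ℝ ↦ (logDeriv E (σ + y * I) - logDeriv xi2 (σ + y * I)) *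
        weilMellin (weilSymm g) (σ + y * I) := by
      have h := integrable_weilMellin_vertical_mul hk σ (hcE.sub hcX) (B := Cv * (3 : ℝ) ^ (-σ))
        (hVline σ hσ)
      exact h.congr (Eventually.of_forall fun y ↦ mul_comm _ _)
    have hVlim : Tendsto (fun n : ℕ ↦
        (∫ y : ℝ in (-T n)..T n, logDeriv E (σ + y * I) * weilMellin (weilSymm g) (σ + y * I)) -
        ∫ y : ℝ in (-T n)..T n, logDeriv xi2 (σ + y * I) * weilMellin (weilSymm g) (σ + y * I))
        atTop (𝓝 (∫ y : ℝ, (logDeriv E (σ + y * I) - logDeriv xi2 (σ + y * I)) *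
          weilMellin (weilSymm g) (σ + y * I))) := by
      have hlim := intervalIntegral_tendsto_integral hint (tendsto_neg_atTop_atBot.comp hTtop) hTtop
      refine hlim.congr fun n ↦ ?_
      have i1 : IntervalIntegrable (fun y : ℝ ↦ logDeriv E (σ + y * I) *
          weilMellin (weilSymm g) (σ + y * I)) volume (-T n) (T n) :=
        (hcE.mul hck).intervalIntegrable _ _
      have i2 : IntervalIntegrable (fun y : ℝ ↦ logDeriv xi2 (σ + y * I) *
          weilMellin (weilSymm g) (σ + y * I)) volume (-T n) (T n) :=
        (hcX.mul hck).intervalIntegrable _ _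
      show (∫ y : ℝ in (-T n)..T n, _) = _
      rw [← intervalIntegral.integral_sub i1 i2]
      exact intervalIntegral.integral_congr fun y _ ↦ by ring
    exact two_pi_mul_sub_eq_of_contour_limits idE idX hSE hSX hbE htE hbX htX hVlim
  -- Step B: `‖J(σ)‖ ≤ K C_V/(σ - 1/2)²` for all `σ ≥ σ₁`, hence `S = W g`
  obtain ⟨K, hK0, hK⟩ := norm_vertical_integral_window_le hg hsupp
  have hSW : (∑' i : ZIdx E, weilMellin g (zval i)) = weilFunctional g := by
    by_contra hne
    set d : ℝ := ‖2 * (π : ℂ) * ((∑' i : ZIdx E, weilMellin g (zval i)) - weilFunctional g)‖ with hd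
    have h2π : (2 * (π : ℂ)) ≠ 0 := mul_ne_zero two_ne_zero (ofReal_ne_zero.2 Real.pi_ne_zero)
    have hdpos : 0 < d := norm_pos_iff.2 (mul_ne_zero h2π (sub_ne_zero.2 hne))
    set σ : ℝ := max σ₁ (K * Cv / d + 3 / 2) with hσdef
    have hσ₁σ : σ₁ ≤ σ := le_max_left _ _
    have hσ2 : K * Cv / d + 3 / 2 ≤ σ := le_max_right _ _
    have ha1 : 1 ≤ σ - 1 / 2 := by linarith
    have hKC : 0 ≤ K * Cv := mul_nonneg hK0 hCv
    have hKCd : 0 ≤ K * Cv / d := div_nonneg hKC hdpos.le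
    have hbound : d ≤ K * Cv / (σ - 1 / 2) ^ 2 := by
      rw [hd, key σ hσ₁σ]
      exact hK _ Cv σ (by linarith) hCv (hVline σ hσ₁σ)
    have h1 : K * Cv / (σ - 1 / 2) ^ 2 ≤ K * Cv / (σ - 1 / 2) :=
      div_le_div_of_nonneg_left hKC (by linarith) (by nlinarith)
    have h2 : K * Cv / (σ - 1 / 2) < d := by
      rw [div_lt_iff₀ (by linarith)]
      calc K * Cv = d * (K * Cv / d) := by field_simp
        _ < d * (σ - 1 / 2) := mul_lt_mul_of_pos_left (by linarith) hdpos
    linarith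
  -- Step C: absolute summability (STUB E) turns `∑'` into `HasSum`
  have hsum := (hE E hEd hEex (hZCB E hS) σ₁ (fun s h0 ↦ wa_zero_strip hsymm hσ₁ hdom le_rfl h0)
    g hg).1
  rw [← hSW]
  exact hsum.of_norm.hasSum

end Summit.RiemannHypothesis.RiemannHypothesis.Theorems.HeckeSurrogate

end
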